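import Mathlib
import Literature.NumberTheory.LFunctions.WeilMarkovQuadratic
import Literature.Barriers.HubbardSuperconductivity.WeakCouplingCeiling
import Summits.RiemannHypothesis.RiemannHypothesis.Theorems.WeilGroundStateArchimedeanWindowSimpleEvenTrial2
import HarnessLib

/-!
# `EvenWinsArch`, stub T1 — `Φ(t) = t · e^{t/2}/(2 sinh t)` is `¼`-Lipschitz from above

For the scale-free archimedean jump kernel `Φ(t) = t · w(t)` of Weil's quadratic form,
`w = weilArchDensity = e^{t/2}/(2 sinh t)` (`Φ(t) = 1/2 + t/4 − t²/48 − …` at `0⁺`), we prove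
`Φ(y) − Φ(x) ≤ (y − x)/4` for all `0 < x ≤ y` (`stub_phiLipschitz`), i.e. `Φ' ≤ 1/4`
on `(0, ∞)`.

Proof. `Φ'(t) = e^{t/2} X(t)/(4 sinh² t)` with `X(t) = (2 + t) sinh t − 2t cosh t`, so it
suffices that `e^{t/2} X(t) ≤ sinh² t` (`exp_mul_le_sinh_sq`). With `e^t = cosh t + sinh t`,
`cosh² t − sinh² t = 1` and the double-angle formulas one has the identity
`(1 + t/2) sinh² t − e^t X(t) = −F(2t)/2`, `F(s) = (2 − s/2) sinh s + (1 − 3s/4)(cosh s − 1) − 2s`,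
and `F = −[(s/2) sinh s − cosh s + 1] − [(3/4) s (cosh s − 1) − 2 sinh s + 2s] ≤ 0` on `[0, ∞)`,
each bracket being `≥ 0` by one resp. two monotonicity steps (`cosh_sub_one_le_half_mul_sinh`,
`kfun_nonneg`). Hence `e^t X ≤ (1 + t/2) sinh² t ≤ e^{t/2} sinh² t` (`1 + t/2 ≤ e^{t/2}`), and
dividing by `e^{t/2}` gives the claim; the Lipschitz bound is then the mean value inequality for
`G(t) = Φ(t) − t/4`, antitone on `(0, ∞)`.

Route `WeilParity`, crux `EvenWinsArch` (stmt-RiemannHypothesis-15433), line `birth`,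
stub `stub_phiLipschitz`.
-/

namespace Summit.RiemannHypothesis.RiemannHypothesis.Theorems.WeilParity.EvenWinsArch

open Literature.NumberTheory.LFunctions
open Literature.Barriers.HubbardSuperconductivity (sinh_le_self_mul_cosh)
open Summit.RiemannHypothesis.RiemannHypothesis.Theorems.WeilGroundState (nonneg_of_hasDerivAt_nonneg)

section PhiLipschitz

open Real Set Filter

/-- `cosh s − 1 ≤ (s/2) sinh s` for `0 ≤ s`: `g = (s/2) sinh s − cosh s + 1` has `g(0) = 0`,
`g' = (s cosh s − sinh s)/2 ≥ 0` (`sinh_le_self_mul_cosh` of `WeakCouplingCeiling.lean`).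
[folklore] -/
theorem cosh_sub_one_le_half_mul_sinh {s : ℝ} (hs : 0 ≤ s) :
    Real.cosh s - 1 ≤ s / 2 * Real.sinh s := by
  have hd : ∀ x, HasDerivAt (fun x : ℝ ↦ x / 2 * Real.sinh x - Real.cosh x + 1)
      ((x * Real.cosh x - Real.sinh x) / 2) x :=
    fun x ↦ (((((hasDerivAt_id' x).div_const 2).fun_mul (Real.hasDerivAt_sinh x)).fun_sub
      (Real.hasDerivAt_cosh x)).add_const 1).congr_deriv (by ring)
  have h : 0 ≤ s / 2 * Real.sinh s - Real.cosh s + 1 :=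
    nonneg_of_hasDerivAt_nonneg (f' := fun x ↦ (x * Real.cosh x - Real.sinh x) / 2) hd (by simp)
      (fun x hx ↦ div_nonneg (sub_nonneg.2 (sinh_le_self_mul_cosh hx)) zero_le_two) hs
  linarith

/-- `k'(s) = 5/4 − (5/4) cosh s + (3/4) s sinh s ≥ 0` for `0 ≤ s`: `k'(0) = 0` and
`k'' = (3/4) s cosh s − (1/2) sinh s ≥ (1/4) sinh s ≥ 0`. [folklore] -/
theorem kfun_deriv_nonneg {s : ℝ} (hs : 0 ≤ s) :
    0 ≤ 5 / 4 - 5 / 4 * Real.cosh s + 3 / 4 * s * Real.sinh s := by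
  have hd : ∀ x, HasDerivAt (fun x : ℝ ↦ 5 / 4 - 5 / 4 * Real.cosh x + 3 / 4 * x * Real.sinh x)
      (3 / 4 * x * Real.cosh x - 1 / 2 * Real.sinh x) x :=
    fun x ↦ ((((Real.hasDerivAt_cosh x).const_mul (5 / 4)).const_sub (5 / 4)).fun_add
      (((hasDerivAt_id' x).const_mul (3 / 4)).fun_mul (Real.hasDerivAt_sinh x))).congr_deriv (by ring)
  refine nonneg_of_hasDerivAt_nonneg (f' := fun x ↦ 3 / 4 * x * Real.cosh x - 1 / 2 * Real.sinh x) hd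
    (by simp) (fun x hx ↦ ?_) hs
  have h1 := sinh_le_self_mul_cosh hx
  have h2 := Real.sinh_nonneg_iff.2 hx
  show 0 ≤ 3 / 4 * x * Real.cosh x - 1 / 2 * Real.sinh x
  nlinarith

/-- `k(s) = (3/4) s (cosh s − 1) − 2 sinh s + 2s ≥ 0` for `0 ≤ s` (`k(0) = 0`, `k' ≥ 0` by
`kfun_deriv_nonneg`), i.e. `2 (sinh s − s) ≤ (3/4) s (cosh s − 1)`. [folklore] -/
theorem kfun_nonneg {s : ℝ} (hs : 0 ≤ s) :
    0 ≤ 3 / 4 * s * (Real.cosh s - 1) - 2 * Real.sinh s + 2 * s := by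
  have hd : ∀ x, HasDerivAt (fun x : ℝ ↦ 3 / 4 * x * (Real.cosh x - 1) - 2 * Real.sinh x + 2 * x)
      (5 / 4 - 5 / 4 * Real.cosh x + 3 / 4 * x * Real.sinh x) x :=
    fun x ↦ (((((hasDerivAt_id' x).const_mul (3 / 4)).fun_mul
      ((Real.hasDerivAt_cosh x).sub_const 1)).fun_sub ((Real.hasDerivAt_sinh x).const_mul 2)).fun_add
      ((hasDerivAt_id' x).const_mul 2)).congr_deriv (by ring)
  exact nonneg_of_hasDerivAt_nonneg
    (f' := fun x ↦ 5 / 4 - 5 / 4 * Real.cosh x + 3 / 4 * x * Real.sinh x) hd (by simp)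
    (fun x hx ↦ kfun_deriv_nonneg hx) hs

/-- **The derivative bound.** For `0 ≤ t`, `e^{t/2} ((2 + t) sinh t − 2t cosh t) ≤ sinh² t`
(equivalently `Φ'(t) ≤ 1/4`): from `F(2t) ≤ 0`, the identity
`(1 + t/2) sinh² t − e^t X(t) = −F(2t)/2` and `1 + t/2 ≤ e^{t/2}`. [folklore] -/
theorem exp_mul_le_sinh_sq {t : ℝ} (ht : 0 ≤ t) :
    Real.exp (t / 2) * ((2 + t) * Real.sinh t - 2 * t * Real.cosh t) ≤ Real.sinh t ^ 2 := by
  have h2t : (0 : ℝ) ≤ 2 * t := by linarith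
  have ha := cosh_sub_one_le_half_mul_sinh h2t
  have hb := kfun_nonneg h2t
  rw [Real.cosh_two_mul, Real.sinh_two_mul] at ha hb
  have hcs := Real.cosh_sq_sub_sinh_sq t
  -- the identity `(1 + t/2) sinh² t − (cosh t + sinh t) X(t) = −F(2t)/2`
  have hId : (1 + t / 2) * Real.sinh t ^ 2 -
      (Real.cosh t + Real.sinh t) * ((2 + t) * Real.sinh t - 2 * t * Real.cosh t) =
      -(1 / 2) * ((2 - t) * (2 * Real.sinh t * Real.cosh t) +
        (1 - 3 * t / 2) * (Real.cosh t ^ 2 + Real.sinh t ^ 2 - 1) - 4 * t) := by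
    linear_combination (1 / 2 + 5 * t / 4) * hcs
  -- `F(2t) ≤ 0`
  have hF : (2 - t) * (2 * Real.sinh t * Real.cosh t) +
      (1 - 3 * t / 2) * (Real.cosh t ^ 2 + Real.sinh t ^ 2 - 1) - 4 * t ≤ 0 := by
    linarith
  have hA : (Real.cosh t + Real.sinh t) * ((2 + t) * Real.sinh t - 2 * t * Real.cosh t) ≤
      (1 + t / 2) * Real.sinh t ^ 2 := by
    linarith
  have hE2 : Real.exp (t / 2) * Real.exp (t / 2) = Real.cosh t + Real.sinh t := by
    rw [← Real.exp_add, add_halves, Real.cosh_add_sinh]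
  have hE1 : 1 + t / 2 ≤ Real.exp (t / 2) := by
    have := Real.add_one_le_exp (t / 2)
    linarith
  have h1 : Real.exp (t / 2) * (Real.exp (t / 2) * ((2 + t) * Real.sinh t - 2 * t * Real.cosh t)) ≤
      Real.exp (t / 2) * Real.sinh t ^ 2 :=
    calc Real.exp (t / 2) * (Real.exp (t / 2) * ((2 + t) * Real.sinh t - 2 * t * Real.cosh t))
        = (Real.cosh t + Real.sinh t) * ((2 + t) * Real.sinh t - 2 * t * Real.cosh t) := by
          rw [← mul_assoc, hE2]
      _ ≤ (1 + t / 2) * Real.sinh t ^ 2 := hA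
      _ ≤ Real.exp (t / 2) * Real.sinh t ^ 2 := mul_le_mul_of_nonneg_right hE1 (sq_nonneg _)
  exact le_of_mul_le_mul_left h1 (Real.exp_pos _)

/-- **`G(t) = t · w(t) − t/4` is differentiable on `(0, ∞)` with `G' ≤ 0`**: for `0 < t`,
`G'(t) = e^{t/2} X(t)/(4 sinh² t) − 1/4 ≤ 0` (`exp_mul_le_sinh_sq`). [folklore] -/
theorem hasDerivAt_mul_weilArchDensity_sub {t : ℝ} (ht : 0 < t) :
    ∃ D ≤ 0, HasDerivAt (fun t : ℝ ↦ t * weilArchDensity t - t / 4) D t := by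
  have hS : 0 < Real.sinh t := Real.sinh_pos_iff.2 ht
  have hS2 : (2 : ℝ) * Real.sinh t ≠ 0 := by positivity
  have hw : HasDerivAt (fun y : ℝ ↦ Real.exp (y / 2) / (2 * Real.sinh y))
      ((Real.exp (t / 2) * (1 / 2) * (2 * Real.sinh t) - Real.exp (t / 2) * (2 * Real.cosh t)) /
        (2 * Real.sinh t) ^ 2) t :=
    ((hasDerivAt_id' t).div_const 2).exp.fun_div ((Real.hasDerivAt_sinh t).const_mul 2) hS2
  have hG := ((hasDerivAt_id' t).fun_mul hw).fun_sub ((hasDerivAt_id' t).div_const 4)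
  refine ⟨_, ?_, hG⟩
  -- the derivative is `e^{t/2} X(t)/(4 sinh² t) − 1/4`
  have hD : 1 * (Real.exp (t / 2) / (2 * Real.sinh t)) +
      t * ((Real.exp (t / 2) * (1 / 2) * (2 * Real.sinh t) - Real.exp (t / 2) * (2 * Real.cosh t)) /
        (2 * Real.sinh t) ^ 2) =
      Real.exp (t / 2) * ((2 + t) * Real.sinh t - 2 * t * Real.cosh t) / (4 * Real.sinh t ^ 2) := by
    field_simp
    ring
  rw [hD, sub_nonpos, div_le_iff₀ (by positivity)]
  have := exp_mul_le_sinh_sq ht.le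
  linarith

/-- **Stub T1 — `Φ` is `¼`-Lipschitz from above.** `Φ(t) = t · e^{t/2}/(2 sinh t)` satisfies
`Φ(y) − Φ(x) ≤ (y − x)/4` for `0 < x ≤ y` (all positive reals): `G = Φ − t/4` is antitone on
`(0, ∞)` (`hasDerivAt_mul_weilArchDensity_sub`, `antitoneOn_of_deriv_nonpos`). [folklore] -/
theorem stub_phiLipschitz :
    ∀ x y : ℝ, 0 < x → x ≤ y →
      y * Literature.NumberTheory.LFunctions.weilArchDensity y -
          x * Literature.NumberTheory.LFunctions.weilArchDensity x ≤ (y - x) / 4 := by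
  intro x y hx hxy
  have hanti : AntitoneOn (fun t : ℝ ↦ t * weilArchDensity t - t / 4) (Ioi 0) := by
    refine antitoneOn_of_deriv_nonpos (convex_Ioi 0) (fun t ht ↦ ?_) ?_ ?_
    · obtain ⟨D, -, hD⟩ := hasDerivAt_mul_weilArchDensity_sub (mem_Ioi.1 ht)
      exact hD.continuousAt.continuousWithinAt
    · rw [interior_Ioi]
      intro t ht
      obtain ⟨D, -, hD⟩ := hasDerivAt_mul_weilArchDensity_sub (mem_Ioi.1 ht)
      exact hD.differentiableAt.differentiableWithinAt
    · rw [interior_Ioi]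
      intro t ht
      obtain ⟨D, hD0, hD⟩ := hasDerivAt_mul_weilArchDensity_sub (mem_Ioi.1 ht)
      rwa [hD.deriv]
  have h : y * weilArchDensity y - y / 4 ≤ x * weilArchDensity x - x / 4 :=
    hanti (mem_Ioi.2 hx) (mem_Ioi.2 (hx.trans_le hxy)) hxy
  linarith

end PhiLipschitz

end Summit.RiemannHypothesis.RiemannHypothesis.Theorems.WeilParity.EvenWinsArch
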